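import Literature.NumberTheory.EllipticCurves.DeligneSerreWeightOneAssembly
import Literature.NumberTheory.EllipticCurves.NewformGaloisRepModLProofs
import Literature.RepresentationTheory.Semisimple.FiniteFieldDescentAbsIrred
import HarnessLib

/-!
# Deligne–Serre 1974, Thm. 4.1 (existence) from Deligne's Thm. 6.1, Chebotarev, and (2.7.2)

A *proofs* file (theorems only, no named fact; D-0026) closing the reduction of the named fact
`Literature.NumberTheory.EllipticCurves.ModularForms.DeligneSerre1974.thm41_exists`
(`NewformGaloisRepProofs`; Deligne–Serre, *Formes modulaires de poids 1*, Thm. 4.1, p. 515: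
*"Il existe une représentation linéaire continue `ρ : G → GL₂(C)`, non ramifiée en dehors de
`N`, telle que `Tr(F_p) = a_p` et `det(F_p) = ε(p)` pour tout `p ∤ N`"*, with §3 (a): the image
is finite) to the three deep inputs of the printed proof that the tree does not prove, each
**stated as printed and taken as a hypothesis** (none is minted here):

* **(A′) Thm. 6.1** (Deligne [5]; op. cit. p. 521): for `f ≠ 0` of type `(k, ε)` on `Γ₀(N)`,
  `k ≥ 2`, an eigenvector of the `T_p` (`p ∤ N`) with eigenvalues `a_p`, `K ⊂ ℂ` a number field
  containing the `a_p` and the `ε(p)`, and **every** finite place `λ` of `K` of residue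
  characteristic `ℓ`, a continuous semisimple `ρ_λ : G → GL₂(K_λ)`, unramified outside `N ℓ`,
  with `det(1 - F_p T) = 1 - a_p T + ε(p) p^{k-1} T²` (6.1.1) — the hypothesis `h61` below, copied
  verbatim from `thm67_weightOne_of_descent` (`NewformGaloisRepModLProofs`), whose author derives
  Thm. 6.7 in weight one from it (6.8–6.13);
* **(B) Chebotarev's density theorem** over `ℚ` in Dirichlet-density form (Neukirch VII (13.4);
  the named fact `Literature.NumberTheory.LFunctions.Chebotarev.dirichletDensity_eq`), used in
  Lemme 8.3 and in (6.12.1);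
* **(C) (2.7.2)** — `S_k(Γ₁(M))` is spanned by the forms all of whose twists `f|R_d` lie in
  `ℤ[[q]]` (the named fact `DeligneSerre1974_span_integralLattice1 M k`) — **in weights `k ≥ 2`
  only**, the range of Shimura 1971, Thm. 3.52 (op. cit. Rem. 2.8); weight one, needed for
  Prop. 2.7, `K_f` and 6.10, is derived from weights `5` and `7`
  (`DeligneSerre1974_span_integralLattice1.of_two_le`, multiplication by `E₄`, `E₆`).

Everything else in op. cit. §§5–8 is proved in the tree and assembled here:

* `thm67_weightOne_of_thm61_of_span` — Thm. 6.7 in weight one (the named fact `thm67_weightOne`,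
  `NewformGaloisRepModL`) from (A′), (B) and (2.7.2) in weight one: `thm67_weightOne_of_descent`
  with its descent hypothesis (Lemme 6.13, `n = 2`, in the kernel/characteristic-polynomial form)
  **discharged** by `Literature.RepresentationTheory.Semisimple.exists_descent_fin_two`
  (`FiniteFieldDescentAbsIrred`, proved);
* `thm41_exists_of_thm61` — Thm. 4.1 (existence) from (A′), (B), (C): the previous theorem fed
  into `thm41_exists_of_leaves₂` (`DeligneSerreWeightOneAssembly`: §8.2–8.6 with Prop. 5.1, 5.5,
  7.2, Lemme 3.2, the lift of 8.6 and Prop. 2.7 all proved).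

So `thm41_exists` now rests on exactly: Deligne's `λ`-adic representations in weight `≥ 2`
(Thm. 6.1), Chebotarev over `ℚ`, and the Eichler–Shimura rational structure of `S_k(Γ₁(M))`,
`k ≥ 2`.

## References

* P. Deligne, J.-P. Serre, *Formes modulaires de poids 1*, Ann. Sci. ÉNS (4) 7 (1974), 507–530:
  Thm. 4.1 (p. 515), Prop. 2.7 and Rem. 2.8 (p. 512), Thm. 6.1 (p. 521), Thm. 6.7 and 6.8–6.13
  (pp. 521–523), §8 (pp. 525–527). [DeligneSerreASENS1974]
* P. Deligne, *Formes modulaires et représentations `ℓ`-adiques*, Sém. Bourbaki 355 (1969)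
  (= [5] of op. cit.).
-/

noncomputable section

open scoped MatrixGroups ModularForm NumberField Polynomial

open CongruenceSubgroup IsDedekindDomain Polynomial Rat.HeightOneSpectrum

namespace Literature.NumberTheory.EllipticCurves.ModularForms.DeligneSerre1974

variable {N : ℕ} [NeZero N]

/-- **Deligne–Serre 1974, Thm. 6.7 in weight one, from Thm. 6.1, Chebotarev and (2.7.2) in
weight one.** For a newform `f ∈ S_1(Γ₁(N))`, a prime `ℓ` and `ι : 𝓞_f → 𝔽_ℓ` there is a
semisimple `ρ : Gal(ℚ̄/ℚ) → GL₂(𝔽_ℓ)` unramified outside `N ℓ` with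
`det(X - ρ(F_p)) = X² - ι(a_p) X + ι(ε(p))` for `p ∤ N ℓ` (`thm67_weightOne`), granted Deligne's
Thm. 6.1 for every finite place (`h61`, as printed, op. cit. p. 521), Chebotarev's density theorem
over `ℚ` (`hCheb`, for (6.12.1)) and (2.7.2) in weight one (`hL`, for Prop. 2.7 and 6.10). This
is `thm67_weightOne_of_descent` (op. cit. 6.8–6.13, proved there) with its descent hypothesis —
Lemme 6.13 for `n = 2` in the form "a `φ : G → GL₂(K)` over a finite field whose characteristic
polynomials lie in `k[X]` admits `ρ : G → GL₂(k)` with `ker φ ≤ ker ρ` and the same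
characteristic polynomials" — discharged by the tree's proof
`Literature.RepresentationTheory.Semisimple.exists_descent_fin_two`.
[cite: DeligneSerreASENS1974, Thm. 6.7 with Thm. 6.1, 6.8–6.13 and Lemme 6.13] -/
theorem thm67_weightOne_of_thm61_of_span
    (h61 : ∀ (M : ℕ) [NeZero M] (k : ℤ), 2 ≤ k →
      ∀ (g : CuspForm (Gamma1 M) k) (χ : DirichletCharacter ℂ M),
        g ∈ nebentypusSubspace M k χ → g ≠ 0 →
      ∀ (K : Type) [Field K] [NumberField K] (e : K →+* ℂ) (a : ℕ → K) (c : ZMod M → K),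
        (∀ d, e (c d) = χ d) →
        (∀ (p : ℕ) (hp : p.Prime), ¬ p ∣ M →
          (haveI : NeZero p := ⟨hp.ne_zero⟩; heckeT (Gamma1 M) k p g) = e (a p) • g) →
      ∀ v : HeightOneSpectrum (𝓞 K),
        ∃ ρ : GaloisRepresentations.FramedGaloisRep ℚ (v.adicCompletion K) 2,
          ρ.toGaloisRep.IsSemisimple ∧
          ∀ w : HeightOneSpectrum (𝓞 ℚ), ¬ ((primesEquiv w : Nat.Primes) : ℕ) ∣ M →
            (((primesEquiv w : Nat.Primes) : ℕ) : 𝓞 K) ∉ v.asIdeal →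
            ρ.IsUnramifiedAt w ∧
            ρ.HasFrobCharpolyAt w
              ((X ^ 2 - C (a ((primesEquiv w : Nat.Primes) : ℕ)) * X +
                C (c ((primesEquiv w : Nat.Primes) : ℕ) *
                  (((primesEquiv w : Nat.Primes) : ℕ) : K) ^ (k - 1))).map
                (algebraMap K (v.adicCompletion K))))
    (hCheb : LFunctions.Chebotarev.dirichletDensity_eq.{0})
    (hL : DeligneSerre1974_span_integralLattice1 N 1) :
    thm67_weightOne (N := N) :=
  thm67_weightOne_of_descent h61
    (fun _ _ _ _ _ _ _ _ j φ _ hQ ↦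
      Literature.RepresentationTheory.Semisimple.exists_descent_fin_two j φ hQ)
    hCheb hL

/-- **Deligne–Serre 1974, Thm. 4.1 (existence, with §3 (a)) from Deligne's Thm. 6.1, Chebotarev,
and (2.7.2) in weights `≥ 2`.** For every newform `f ∈ S_1(Γ₁(N))` there is a continuous
representation `Gal(ℚ̄/ℚ) → GL₂(ℂ)` with finite image attached to `f` away from `N`
(`thm41_exists`), granted: (A′) Deligne's `λ`-adic representations attached to eigenforms of
weight `k ≥ 2` at **every** finite place `λ` (Thm. 6.1 as printed, `h61`); (B) Chebotarev's
density theorem over `ℚ` (`Chebotarev.dirichletDensity_eq`; Lemme 8.3 and (6.12.1)); (C) the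
spanning statement (2.7.2) for `S_k(Γ₁(M))`, all `M ≥ 1` and `k ≥ 2` (Shimura 1971, Thm. 3.52;
weight one by Rem. 2.8). The rest of the printed proof is proved in the tree: Thm. 6.7 from 6.1
(`thm67_weightOne_of_thm61_of_span`: 6.8–6.13 with Lemme 6.13), and §8.2–8.6 with Prop. 5.1, 5.5,
7.2, 2.7, Lemme 3.2 and the lift of 8.6 (`thm41_exists_of_leaves₂`).
[cite: DeligneSerreASENS1974, Thm. 4.1; proof §8 with Thm. 6.1, Thm. 6.7, Prop. 2.7, Rem. 2.8] -/
theorem thm41_exists_of_thm61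
    (h61 : ∀ (M : ℕ) [NeZero M] (k : ℤ), 2 ≤ k →
      ∀ (g : CuspForm (Gamma1 M) k) (χ : DirichletCharacter ℂ M),
        g ∈ nebentypusSubspace M k χ → g ≠ 0 →
      ∀ (K : Type) [Field K] [NumberField K] (e : K →+* ℂ) (a : ℕ → K) (c : ZMod M → K),
        (∀ d, e (c d) = χ d) →
        (∀ (p : ℕ) (hp : p.Prime), ¬ p ∣ M →
          (haveI : NeZero p := ⟨hp.ne_zero⟩; heckeT (Gamma1 M) k p g) = e (a p) • g) →
      ∀ v : HeightOneSpectrum (𝓞 K),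
        ∃ ρ : GaloisRepresentations.FramedGaloisRep ℚ (v.adicCompletion K) 2,
          ρ.toGaloisRep.IsSemisimple ∧
          ∀ w : HeightOneSpectrum (𝓞 ℚ), ¬ ((primesEquiv w : Nat.Primes) : ℕ) ∣ M →
            (((primesEquiv w : Nat.Primes) : ℕ) : 𝓞 K) ∉ v.asIdeal →
            ρ.IsUnramifiedAt w ∧
            ρ.HasFrobCharpolyAt w
              ((X ^ 2 - C (a ((primesEquiv w : Nat.Primes) : ℕ)) * X +
                C (c ((primesEquiv w : Nat.Primes) : ℕ) *
                  (((primesEquiv w : Nat.Primes) : ℕ) : K) ^ (k - 1))).map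
                (algebraMap K (v.adicCompletion K))))
    (hCheb : LFunctions.Chebotarev.dirichletDensity_eq.{0})
    (hL : ∀ (M : ℕ) [NeZero M] (k : ℤ), 2 ≤ k → DeligneSerre1974_span_integralLattice1 M k) :
    thm41_exists (N := N) :=
  thm41_exists_of_leaves₂
    (thm67_weightOne_of_thm61_of_span h61 hCheb
      (DeligneSerre1974_span_integralLattice1.of_two_le (hL N) 1))
    hCheb hL

end Literature.NumberTheory.EllipticCurves.ModularForms.DeligneSerre1974
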